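import Mathlib
import Summits.Ventures.PercRepro2.SwOutCrossGenIterDefs

/-!
# Abstract cubes and their independent products (blind cell PercRepro2, night-4 g24, 2026-08-28;
proofs/NIGHT4-G24.md §14)

A **cube** is the minimal structure the inequality of boundary (iv) speaks about: finitely many
points, atoms, types, a leak, the red and the blue atoms of a point, its type, and a reflexive
order on types.  `Cube.Ineq`: on every up-set of types the red count is at most the blue count
for every up-set of atom sets.  A `FibreIter` over a u-arm set is a cube (`FibreIter.cube`, with
`Ineq F ι ↔ (F.cube ι).Ineq`), and the **independent product** of two cubes (`Cube.prod`: the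
leak of either, the union of the atoms, the product order) has the inequality whenever both
factors have it (`Cube.ineq_prod`, the two-freeze proof of `SwOutCrossGenJunctions` in the
abstract setting) — so that the inequality passes to any number of independent junctions
(`Cube.prodList`, `Cube.ineq_prodList`).
-/

namespace Summit.Ventures.PercRepro2

namespace CrossArm

universe u

/-- **An abstract cube**: what the inequality of boundary (iv) speaks about. -/
structure Cube : Type (u + 1) where
  /-- the points -/
  Pt : Type u
  /-- the atoms -/
  Atom : Type u
  /-- the types -/
  Typ : Type u
  /-- the leak -/
  leak : Pt → Prop
  /-- the red atoms of a point -/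
  er : Pt → Set Atom
  /-- the blue atoms of a point -/
  eb : Pt → Set Atom
  /-- the type of a point -/
  typ : Pt → Typ
  /-- `Better t' t`: `t'` is at least as good a type as `t` -/
  Better : Typ → Typ → Prop
  /-- `Better` is reflexive -/
  better_refl : ∀ t, Better t t
  /-- the points are finite -/
  [fPt : Fintype Pt]

namespace Cube

variable (C : Cube.{u})

/-- An up-set of types. -/
def IsUp (𝒯 : Set C.Typ) : Prop := ∀ t ∈ 𝒯, ∀ t', C.Better t' t → t' ∈ 𝒯

open scoped Classical in
/-- The non-leaking points whose type lies in `𝒯`. -/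
noncomputable def Q (𝒯 : Set C.Typ) : Finset C.Pt :=
  letI := C.fPt
  Finset.univ.filter fun x => ¬ C.leak x ∧ C.typ x ∈ 𝒯

open scoped Classical in
/-- **The inequality of a cube.** -/
def Ineq : Prop :=
  ∀ (𝒯 : Set C.Typ) (𝓔 : Set (Set C.Atom)), C.IsUp 𝒯 → IsUpperSet 𝓔 →
    ((C.Q 𝒯).filter fun x => C.er x ∈ 𝓔).card ≤ ((C.Q 𝒯).filter fun x => C.eb x ∈ 𝓔).card

/-- Membership in `Q`. -/
lemma mem_Q {𝒯 : Set C.Typ} {x : C.Pt} : x ∈ C.Q 𝒯 ↔ ¬ C.leak x ∧ C.typ x ∈ 𝒯 := by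
  letI := C.fPt
  simp only [Q, Finset.mem_filter, Finset.mem_univ, true_and]

end Cube

section FibreCube

variable {W A L ι : Type u} (F : FibreIter W A L) [Fintype ι] [DecidableEq ι] [Fintype W]

/-- A fibre over a u-arm set as a cube. -/
@[reducible] def FibreIter.cube : Cube.{u} where
  Pt := PtG W ι
  Atom := AtomG A ι
  Typ := TypG L ι
  leak := LeakI F
  er := ERI F
  eb := EBI F
  typ := typI F
  Better := BetterI F
  better_refl := fun _ => ⟨fun _ h => h, F.betterL_refl _⟩

open scoped Classical

/-- The non-leaking points of the fibre's cube are those of the fibre. -/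
lemma Q_cube (𝒯 : Set (TypG L ι)) : (F.cube (ι := ι)).Q 𝒯 = QI F 𝒯 := by
  ext x
  rw [Cube.mem_Q, mem_QI]

/-- The inequality of the fibre is the inequality of its cube. -/
lemma ineq_cube_iff : (F.cube (ι := ι)).Ineq ↔ Ineq F (ι := ι) := by
  constructor
  · intro h 𝒯 𝓔 h𝒯 h𝓔
    have := h 𝒯 𝓔 h𝒯 h𝓔
    rwa [Q_cube] at this
  · intro h 𝒯 𝓔 h𝒯 h𝓔
    have := h 𝒯 𝓔 h𝒯 h𝓔
    rwa [← Q_cube] at this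

end FibreCube

namespace Cube

section Prod

variable (C₁ C₂ : Cube.{u})

/-- **The independent product of two cubes**: the leak of either, the union of the atoms, the
product order on types. -/
@[reducible] def prod : Cube.{u} where
  Pt := C₁.Pt × C₂.Pt
  Atom := C₁.Atom ⊕ C₂.Atom
  Typ := C₁.Typ × C₂.Typ
  leak := fun x => C₁.leak x.1 ∨ C₂.leak x.2
  er := fun x => Sum.inl '' C₁.er x.1 ∪ Sum.inr '' C₂.er x.2
  eb := fun x => Sum.inl '' C₁.eb x.1 ∪ Sum.inr '' C₂.eb x.2
  typ := fun x => (C₁.typ x.1, C₂.typ x.2)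
  Better := fun t' t => C₁.Better t'.1 t.1 ∧ C₂.Better t'.2 t.2
  better_refl := fun _ => ⟨C₁.better_refl _, C₂.better_refl _⟩
  fPt := letI := C₁.fPt; letI := C₂.fPt; inferInstance

/-- The mixed set of a point of the product: the blue atoms of the first factor, the red atoms of
the second. -/
def mixed (x : C₁.Pt × C₂.Pt) : Set (C₁.Atom ⊕ C₂.Atom) :=
  Sum.inl '' C₁.eb x.1 ∪ Sum.inr '' C₂.er x.2

/-- The slice of an up-set of product types at a type of the second factor. -/
def sliceT₁ (𝒯 : Set (C₁.Typ × C₂.Typ)) (t₂ : C₂.Typ) : Set C₁.Typ := {t₁ | (t₁, t₂) ∈ 𝒯}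

/-- The slice of an up-set of product types at a type of the first factor. -/
def sliceT₂ (𝒯 : Set (C₁.Typ × C₂.Typ)) (t₁ : C₁.Typ) : Set C₂.Typ := {t₂ | (t₁, t₂) ∈ 𝒯}

/-- The slice of an up-set of atom sets at an atom set of the second factor. -/
def sliceE₁ (𝓔 : Set (Set (C₁.Atom ⊕ C₂.Atom))) (S₂ : Set C₂.Atom) : Set (Set C₁.Atom) :=
  {S | Sum.inl '' S ∪ Sum.inr '' S₂ ∈ 𝓔}

/-- The slice of an up-set of atom sets at an atom set of the first factor. -/
def sliceE₂ (𝓔 : Set (Set (C₁.Atom ⊕ C₂.Atom))) (S₁ : Set C₁.Atom) : Set (Set C₂.Atom) :=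
  {S | Sum.inl '' S₁ ∪ Sum.inr '' S ∈ 𝓔}

/-- The slices of an up-set of product types are up-sets. -/
lemma isUp_sliceT₁ {𝒯 : Set (C₁.Typ × C₂.Typ)} (h𝒯 : (C₁.prod C₂).IsUp 𝒯) (t₂ : C₂.Typ) :
    C₁.IsUp (sliceT₁ C₁ C₂ 𝒯 t₂) :=
  fun _ ht _ hle => h𝒯 _ ht _ ⟨hle, C₂.better_refl t₂⟩

/-- The slices of an up-set of product types are up-sets. -/
lemma isUp_sliceT₂ {𝒯 : Set (C₁.Typ × C₂.Typ)} (h𝒯 : (C₁.prod C₂).IsUp 𝒯) (t₁ : C₁.Typ) :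
    C₂.IsUp (sliceT₂ C₁ C₂ 𝒯 t₁) :=
  fun _ ht _ hle => h𝒯 _ ht _ ⟨C₁.better_refl t₁, hle⟩

/-- The slices of an up-set of atom sets are up-sets. -/
lemma isUpperSet_sliceE₁ {𝓔 : Set (Set (C₁.Atom ⊕ C₂.Atom))} (h𝓔 : IsUpperSet 𝓔) (S₂ : Set C₂.Atom) :
    IsUpperSet (sliceE₁ C₁ C₂ 𝓔 S₂) :=
  fun _ _ hle h => h𝓔 (Set.union_subset_union_left _ (Set.image_mono hle)) h

/-- The slices of an up-set of atom sets are up-sets. -/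
lemma isUpperSet_sliceE₂ {𝓔 : Set (Set (C₁.Atom ⊕ C₂.Atom))} (h𝓔 : IsUpperSet 𝓔) (S₁ : Set C₁.Atom) :
    IsUpperSet (sliceE₂ C₁ C₂ 𝓔 S₁) :=
  fun _ _ hle h => h𝓔 (Set.union_subset_union_right _ (Set.image_mono hle)) h

open scoped Classical

/-- **Step 1, the second factor frozen**: the red count is at most the mixed count. -/
lemma card_red_le_mixed (h₁ : C₁.Ineq) {𝒯 : Set (C₁.Typ × C₂.Typ)} (h𝒯 : (C₁.prod C₂).IsUp 𝒯)
    {𝓔 : Set (Set (C₁.Atom ⊕ C₂.Atom))} (h𝓔 : IsUpperSet 𝓔) (c : C₂.Pt) :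
    (((C₁.prod C₂).Q 𝒯).filter fun x => x.2 = c ∧ (C₁.prod C₂).er x ∈ 𝓔).card ≤
      (((C₁.prod C₂).Q 𝒯).filter fun x => x.2 = c ∧ mixed C₁ C₂ x ∈ 𝓔).card := by
  by_cases hc : C₂.leak c
  · have h0 : ∀ P : C₁.Pt × C₂.Pt → Prop,
        (((C₁.prod C₂).Q 𝒯).filter fun x => x.2 = c ∧ P x) = ∅ := by
      intro P
      rw [Finset.filter_eq_empty_iff]
      rintro x hx ⟨hxc, -⟩
      exact ((C₁.prod C₂).mem_Q.1 hx).1 (Or.inr (hxc ▸ hc))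
    rw [h0, h0]
  have key := h₁ _ _ (isUp_sliceT₁ C₁ C₂ h𝒯 (C₂.typ c)) (isUpperSet_sliceE₁ C₁ C₂ h𝓔 (C₂.er c))
  have e1 : (((C₁.prod C₂).Q 𝒯).filter fun x => x.2 = c ∧ (C₁.prod C₂).er x ∈ 𝓔).card =
      ((C₁.Q (sliceT₁ C₁ C₂ 𝒯 (C₂.typ c))).filter fun q => C₁.er q ∈ sliceE₁ C₁ C₂ 𝓔 (C₂.er c)).card := by
    refine Finset.card_bij' (fun x _ => x.1) (fun q _ => (q, c)) ?_ ?_ ?_ ?_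
    · intro x hx
      rw [Finset.mem_filter, Cube.mem_Q] at hx
      obtain ⟨⟨hl, ht⟩, hxc, hE⟩ := hx
      rw [Finset.mem_filter, Cube.mem_Q]
      refine ⟨⟨fun h => hl (Or.inl h), ?_⟩, ?_⟩
      · show (C₁.typ x.1, C₂.typ c) ∈ 𝒯
        rw [← hxc]; exact ht
      · show Sum.inl '' C₁.er x.1 ∪ Sum.inr '' C₂.er c ∈ 𝓔
        rw [← hxc]; exact hE
    · intro q hq
      rw [Finset.mem_filter, Cube.mem_Q] at hq
      obtain ⟨⟨hl, ht⟩, hE⟩ := hq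
      rw [Finset.mem_filter, Cube.mem_Q]
      exact ⟨⟨fun h => h.elim hl hc, ht⟩, rfl, hE⟩
    · intro x hx
      rw [Finset.mem_filter] at hx
      exact Prod.ext rfl hx.2.1.symm
    · intro q _
      rfl
  have e2 : (((C₁.prod C₂).Q 𝒯).filter fun x => x.2 = c ∧ mixed C₁ C₂ x ∈ 𝓔).card =
      ((C₁.Q (sliceT₁ C₁ C₂ 𝒯 (C₂.typ c))).filter fun q => C₁.eb q ∈ sliceE₁ C₁ C₂ 𝓔 (C₂.er c)).card := by
    refine Finset.card_bij' (fun x _ => x.1) (fun q _ => (q, c)) ?_ ?_ ?_ ?_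
    · intro x hx
      rw [Finset.mem_filter, Cube.mem_Q] at hx
      obtain ⟨⟨hl, ht⟩, hxc, hE⟩ := hx
      rw [Finset.mem_filter, Cube.mem_Q]
      refine ⟨⟨fun h => hl (Or.inl h), ?_⟩, ?_⟩
      · show (C₁.typ x.1, C₂.typ c) ∈ 𝒯
        rw [← hxc]; exact ht
      · show Sum.inl '' C₁.eb x.1 ∪ Sum.inr '' C₂.er c ∈ 𝓔
        rw [← hxc]; exact hE
    · intro q hq
      rw [Finset.mem_filter, Cube.mem_Q] at hq
      obtain ⟨⟨hl, ht⟩, hE⟩ := hq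
      rw [Finset.mem_filter, Cube.mem_Q]
      exact ⟨⟨fun h => h.elim hl hc, ht⟩, rfl, hE⟩
    · intro x hx
      rw [Finset.mem_filter] at hx
      exact Prod.ext rfl hx.2.1.symm
    · intro q _
      rfl
  rw [e1, e2]
  exact key

/-- **Step 2, the first factor frozen**: the mixed count is at most the blue count. -/
lemma card_mixed_le_blue (h₂ : C₂.Ineq) {𝒯 : Set (C₁.Typ × C₂.Typ)} (h𝒯 : (C₁.prod C₂).IsUp 𝒯)
    {𝓔 : Set (Set (C₁.Atom ⊕ C₂.Atom))} (h𝓔 : IsUpperSet 𝓔) (q : C₁.Pt) :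
    (((C₁.prod C₂).Q 𝒯).filter fun x => x.1 = q ∧ mixed C₁ C₂ x ∈ 𝓔).card ≤
      (((C₁.prod C₂).Q 𝒯).filter fun x => x.1 = q ∧ (C₁.prod C₂).eb x ∈ 𝓔).card := by
  by_cases hq : C₁.leak q
  · have h0 : ∀ P : C₁.Pt × C₂.Pt → Prop,
        (((C₁.prod C₂).Q 𝒯).filter fun x => x.1 = q ∧ P x) = ∅ := by
      intro P
      rw [Finset.filter_eq_empty_iff]
      rintro x hx ⟨hxq, -⟩
      exact ((C₁.prod C₂).mem_Q.1 hx).1 (Or.inl (hxq ▸ hq))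
    rw [h0, h0]
  have key := h₂ _ _ (isUp_sliceT₂ C₁ C₂ h𝒯 (C₁.typ q)) (isUpperSet_sliceE₂ C₁ C₂ h𝓔 (C₁.eb q))
  have e1 : (((C₁.prod C₂).Q 𝒯).filter fun x => x.1 = q ∧ mixed C₁ C₂ x ∈ 𝓔).card =
      ((C₂.Q (sliceT₂ C₁ C₂ 𝒯 (C₁.typ q))).filter fun c => C₂.er c ∈ sliceE₂ C₁ C₂ 𝓔 (C₁.eb q)).card := by
    refine Finset.card_bij' (fun x _ => x.2) (fun c _ => (q, c)) ?_ ?_ ?_ ?_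
    · intro x hx
      rw [Finset.mem_filter, Cube.mem_Q] at hx
      obtain ⟨⟨hl, ht⟩, hxq, hE⟩ := hx
      rw [Finset.mem_filter, Cube.mem_Q]
      refine ⟨⟨fun h => hl (Or.inr h), ?_⟩, ?_⟩
      · show (C₁.typ q, C₂.typ x.2) ∈ 𝒯
        rw [← hxq]; exact ht
      · show Sum.inl '' C₁.eb q ∪ Sum.inr '' C₂.er x.2 ∈ 𝓔
        rw [← hxq]; exact hE
    · intro c hc
      rw [Finset.mem_filter, Cube.mem_Q] at hc
      obtain ⟨⟨hl, ht⟩, hE⟩ := hc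
      rw [Finset.mem_filter, Cube.mem_Q]
      exact ⟨⟨fun h => h.elim hq hl, ht⟩, rfl, hE⟩
    · intro x hx
      rw [Finset.mem_filter] at hx
      exact Prod.ext hx.2.1.symm rfl
    · intro c _
      rfl
  have e2 : (((C₁.prod C₂).Q 𝒯).filter fun x => x.1 = q ∧ (C₁.prod C₂).eb x ∈ 𝓔).card =
      ((C₂.Q (sliceT₂ C₁ C₂ 𝒯 (C₁.typ q))).filter fun c => C₂.eb c ∈ sliceE₂ C₁ C₂ 𝓔 (C₁.eb q)).card := by
    refine Finset.card_bij' (fun x _ => x.2) (fun c _ => (q, c)) ?_ ?_ ?_ ?_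
    · intro x hx
      rw [Finset.mem_filter, Cube.mem_Q] at hx
      obtain ⟨⟨hl, ht⟩, hxq, hE⟩ := hx
      rw [Finset.mem_filter, Cube.mem_Q]
      refine ⟨⟨fun h => hl (Or.inr h), ?_⟩, ?_⟩
      · show (C₁.typ q, C₂.typ x.2) ∈ 𝒯
        rw [← hxq]; exact ht
      · show Sum.inl '' C₁.eb q ∪ Sum.inr '' C₂.eb x.2 ∈ 𝓔
        rw [← hxq]; exact hE
    · intro c hc
      rw [Finset.mem_filter, Cube.mem_Q] at hc
      obtain ⟨⟨hl, ht⟩, hE⟩ := hc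
      rw [Finset.mem_filter, Cube.mem_Q]
      exact ⟨⟨fun h => h.elim hq hl, ht⟩, rfl, hE⟩
    · intro x hx
      rw [Finset.mem_filter] at hx
      exact Prod.ext hx.2.1.symm rfl
    · intro c _
      rfl
  rw [e1, e2]
  exact key

/-- A count over the product, fibred by the second factor. -/
lemma card_fibre₂ {𝒯 : Set (C₁.Typ × C₂.Typ)} (P : C₁.Pt × C₂.Pt → Prop) :
    (((C₁.prod C₂).Q 𝒯).filter fun x => P x).card =
      ∑ c ∈ (letI := C₂.fPt; Finset.univ : Finset C₂.Pt),
        (((C₁.prod C₂).Q 𝒯).filter fun x => x.2 = c ∧ P x).card := by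
  letI := C₂.fPt
  rw [Finset.card_eq_sum_card_fiberwise (f := fun x => x.2) (t := Finset.univ)
    (fun _ _ => Finset.mem_univ _)]
  refine Finset.sum_congr rfl fun c _ => ?_
  rw [Finset.filter_filter]
  congr 1
  exact Finset.filter_congr fun _ _ => and_comm

/-- A count over the product, fibred by the first factor. -/
lemma card_fibre₁ {𝒯 : Set (C₁.Typ × C₂.Typ)} (P : C₁.Pt × C₂.Pt → Prop) :
    (((C₁.prod C₂).Q 𝒯).filter fun x => P x).card =
      ∑ q ∈ (letI := C₁.fPt; Finset.univ : Finset C₁.Pt),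
        (((C₁.prod C₂).Q 𝒯).filter fun x => x.1 = q ∧ P x).card := by
  letI := C₁.fPt
  rw [Finset.card_eq_sum_card_fiberwise (f := fun x => x.1) (t := Finset.univ)
    (fun _ _ => Finset.mem_univ _)]
  refine Finset.sum_congr rfl fun q _ => ?_
  rw [Finset.filter_filter]
  congr 1
  exact Finset.filter_congr fun _ _ => and_comm

/-- **THE INEQUALITY OF AN INDEPENDENT PRODUCT** from the inequalities of the factors. -/
theorem ineq_prod (h₁ : C₁.Ineq) (h₂ : C₂.Ineq) : (C₁.prod C₂).Ineq := by
  intro 𝒯 𝓔 h𝒯 h𝓔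
  calc (((C₁.prod C₂).Q 𝒯).filter fun x => (C₁.prod C₂).er x ∈ 𝓔).card
      = ∑ c ∈ (letI := C₂.fPt; Finset.univ : Finset C₂.Pt),
          (((C₁.prod C₂).Q 𝒯).filter fun x => x.2 = c ∧ (C₁.prod C₂).er x ∈ 𝓔).card :=
        card_fibre₂ C₁ C₂ _
    _ ≤ ∑ c ∈ (letI := C₂.fPt; Finset.univ : Finset C₂.Pt),
          (((C₁.prod C₂).Q 𝒯).filter fun x => x.2 = c ∧ mixed C₁ C₂ x ∈ 𝓔).card :=
        Finset.sum_le_sum fun c _ => card_red_le_mixed C₁ C₂ h₁ h𝒯 h𝓔 c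
    _ = (((C₁.prod C₂).Q 𝒯).filter fun x => mixed C₁ C₂ x ∈ 𝓔).card := (card_fibre₂ C₁ C₂ _).symm
    _ = ∑ q ∈ (letI := C₁.fPt; Finset.univ : Finset C₁.Pt),
          (((C₁.prod C₂).Q 𝒯).filter fun x => x.1 = q ∧ mixed C₁ C₂ x ∈ 𝓔).card :=
        card_fibre₁ C₁ C₂ _
    _ ≤ ∑ q ∈ (letI := C₁.fPt; Finset.univ : Finset C₁.Pt),
          (((C₁.prod C₂).Q 𝒯).filter fun x => x.1 = q ∧ (C₁.prod C₂).eb x ∈ 𝓔).card :=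
        Finset.sum_le_sum fun q _ => card_mixed_le_blue C₁ C₂ h₂ h𝒯 h𝓔 q
    _ = (((C₁.prod C₂).Q 𝒯).filter fun x => (C₁.prod C₂).eb x ∈ 𝓔).card := (card_fibre₁ C₁ C₂ _).symm

end Prod

section List

/-- The independent product of a cube with a list of cubes. -/
def prodList (C : Cube.{u}) : List Cube.{u} → Cube.{u}
  | [] => C
  | D :: l => (C.prodList l).prod D

/-- **The inequality of an independent product of any number of cubes.** -/
theorem ineq_prodList (C : Cube.{u}) (hC : C.Ineq) :
    ∀ l : List Cube.{u}, (∀ D ∈ l, D.Ineq) → (C.prodList l).Ineq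
  | [], _ => hC
  | D :: l, h => ineq_prod _ _ (ineq_prodList C hC l fun D' hD' => h D' (List.mem_cons_of_mem _ hD'))
      (h D List.mem_cons_self)

end List

end Cube

end CrossArm

end Summit.Ventures.PercRepro2
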